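import Mathlib
import Literature.Analysis.FluidPDE.Tao2016AveragedNS.BoundedEternalSolutions
import Literature.Analysis.FluidPDE.Tao2016AveragedNS.SelfSimilarCascadeResidues
import Summits.NavierStokesRegularity.NavierStokesRegularity.Theorems.WakeRatchetTailRatchetMultiplicativeNoGo
import Summits.NavierStokesRegularity.NavierStokesRegularity.Theorems.WakeRatchetTailRatchetSeededTodaClass
import Summits.NavierStokesRegularity.NavierStokesRegularity.Theorems.WakeRatchetTailRatchetDSSVisc
import Summits.NavierStokesRegularity.NavierStokesRegularity.Theorems.WakeRatchetTailRatchet.Negative.TailRatchetFalseOfPersistentDSSWaves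
import HarnessLib

/-!
# `WakeRatchet.TailRatchet` (stmt-NavierStokesRegularity-21808) and the SEEDED GRADED TODA MEMBER
# `T_ε ∈ E₂(2/ε)` — Part II: the unseeded member carries NO admissible DSS wave; kill criteria at
# FIXED seed (the door through the tree's PROVED `PerpetualPump.CircuitPump` machinery)

Continuation of `…SeededTodaClass` (the table `T_ε`, its membership `inTableClass_seededToda` in
`E₂(2/ε)` for `0 < ε ≤ 1`, its drive coordinates `seededToda_drive`).  Here:

* `eq_zero_of_hasDerivAt_damped_mul_integrable` — bounded solutions of `φ' = −φ + hφ` with an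
  INTEGRABLE multiplier `h` vanish (sharper than `WakeRatchetMultiplicativeNoGo`, which asks `h → 0`);
* coordinate API of admissible DSS waves on `m = 4` tables (`dss_hasDerivAt_coord`,
  `dss_continuous_coord`, `dss_bounded_coord`, `dss_integrable_coord`);
* `unseededToda_dssWave_trivial` — **the unseeded member `T_0 ∈ E₂(2)` carries no non-trivial
  admissible DSS wave** (any scale ratio, period, delay): the bond row `v̇ = −v + (a − Λ⁻¹a₊)v` is
  multiplicative with an integrable multiplier, so bonds vanish, then carriers and inert coordinates
  decay freely.  Hence every «no DSS wave» predicate holds VACUOUSLY on `T_0`; the seed `ε a²` of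
  `CircuitPump` is indispensable;
* `TailRatchet_false_of_seededTodaDSSWaves` / `TailRatchet_false_of_seededTodaViscousPumps` —
  KILL CRITERIA AT FIXED SEED: admissible DSS waves, or uniformly bounded admissible viscous
  block-DSS eternal solutions (the exact output shape of `CircuitPump`: period `1`, delay
  `2 log(1+ε₀)`, `ν̂ = 1`, read in renormalised variables with the admissibility clauses), of `T_ε`
  for ONE `ε ∈ (0,1]` at arbitrarily small `ε₀`, refute `TailRatchet` (`R = 2/ε`).  `CircuitPump`
  itself chooses `ε = ε(λ) → 0` as `λ ↓ 1` (`PerpetualPumpCircuitPumpClockBoxEps`), i.e. unbounded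
  spread: the construction that would close stmt-21808 through this door is its clock box (stub A)
  made uniform in `λ ↓ 1` at fixed seed, plus the admissibility decay of the orbit.

HONEST FRAMING: MODEL lattice ODEs only (Tao 2016 §4); nothing here concerns the Navier–Stokes
equations; stmt-21808 is neither proved nor refuted here.
-/

noncomputable section

set_option linter.dupNamespace false

namespace Summit.NavierStokesRegularity.NavierStokesRegularity.Theorems

namespace WakeRatchetSeededToda

open MeasureTheory Set Filter Topology intervalIntegral
open Literature.Analysis.FluidPDE Literature.Analysis.FluidPDE.TaoCascade
open WakeRatchetMultiplicativeNoGo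

/-! ## The scalar no-go with an INTEGRABLE multiplier -/

/-- **Bounded solutions of `φ' = −φ + h φ` with `h` integrable vanish identically**: by variation of
constants `|φ(x)| = |φ(0)| exp(−x − ∫ₓ⁰ h) ≥ |φ(0)| e^{|x| − ‖h‖₁} → ∞` as `x → −∞`.  (Sharper than
`eq_zero_of_hasDerivAt_damped_mul`, which asks `h → 0`.) [folklore] -/
theorem eq_zero_of_hasDerivAt_damped_mul_integrable {φ h : ℝ → ℝ} (hh : Continuous h)
    (hint : Integrable h) (hφ : ∀ x, HasDerivAt φ (-φ x + h x * φ x) x)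
    (hB : ∃ B : ℝ, ∀ x, |φ x| ≤ B) : ∀ x, φ x = 0 := by
  obtain ⟨B, hB⟩ := hB
  have hg : Continuous (fun x => h x - 1) := hh.sub continuous_const
  have hφ' : ∀ x, HasDerivAt φ ((h x - 1) * φ x) x := fun x => (hφ x).congr_deriv (by ring)
  suffices h0 : φ 0 = 0 by
    intro x
    rw [eq_mul_exp_integral_of_hasDerivAt hg hφ' x, h0, zero_mul]
  by_contra h0
  have hφ0 : 0 < |φ 0| := abs_pos.2 h0
  have hB0 : 0 ≤ B := (abs_nonneg _).trans (hB 0)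
  set I : ℝ := ∫ t, |h t| with hIdef
  have hdiv : 0 ≤ B / |φ 0| := div_nonneg hB0 hφ0.le
  set x : ℝ := -(I + B / |φ 0| + 1) with hxdef
  have hI0 : 0 ≤ I := integral_nonneg fun _ => abs_nonneg _
  have hx0 : x ≤ 0 := by rw [hxdef]; linarith
  -- `∫₀ˣ (h − 1) = −∫ₓ⁰ h − x`
  have hsplit : ∫ t in (0 : ℝ)..x, (h t - 1) = -(∫ t in x..(0 : ℝ), h t) + (-x) := by
    rw [integral_symm, intervalIntegral.integral_sub (hh.intervalIntegrable _ _)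
      intervalIntegrable_const, intervalIntegral.integral_const, smul_eq_mul]
    ring
  have hbound : |∫ t in x..(0 : ℝ), h t| ≤ I := by
    rw [intervalIntegral.integral_of_le hx0]
    calc |∫ t in Set.Ioc x 0, h t| ≤ ∫ t in Set.Ioc x 0, |h t| := abs_integral_le_integral_abs
      _ ≤ I := setIntegral_le_integral hint.abs (Eventually.of_forall fun _ => abs_nonneg _)
  have hGx : B / |φ 0| + 1 ≤ ∫ t in (0 : ℝ)..x, (h t - 1) := by
    rw [hsplit]
    have h1 := le_abs_self (∫ t in x..(0 : ℝ), h t)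
    have hx : -x = I + B / |φ 0| + 1 := by rw [hxdef]; ring
    linarith
  have hφx : |φ x| = |φ 0| * Real.exp (∫ t in (0 : ℝ)..x, (h t - 1)) := by
    rw [eq_mul_exp_integral_of_hasDerivAt hg hφ' x, abs_mul, Real.abs_exp]
  have hge : |φ 0| * (B / |φ 0| + 2) ≤ |φ x| := by
    rw [hφx]
    refine mul_le_mul_of_nonneg_left ?_ hφ0.le
    have h1 := Real.add_one_le_exp (∫ t in (0 : ℝ)..x, (h t - 1))
    linarith
  have hval : |φ 0| * (B / |φ 0| + 2) = B + 2 * |φ 0| := by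
    field_simp
  linarith [hB x]

/-- Free decay `φ' = −φ` has no non-zero bounded solution on `ℝ`. [folklore] -/
theorem eq_zero_of_hasDerivAt_free {φ : ℝ → ℝ} (hφ : ∀ x, HasDerivAt φ (-φ x) x)
    (hB : ∃ B : ℝ, ∀ x, |φ x| ≤ B) : ∀ x, φ x = 0 :=
  eq_zero_of_hasDerivAt_damped_mul (h := fun _ => 0) continuous_const tendsto_const_nhds
    (fun x => by simpa using hφ x) hB

/-! ## Coordinates of admissible DSS waves (any table, `m = 4`) -/

section DSS

variable {ρ : Type*} [Fintype ρ] {ε₀ : ℝ} {α : Fin 4 → Fin 4 → Fin 4 → ℤ × ℤ × ℤ → ℝ}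
  {π : Equiv.Perm ρ} {T : ℝ} {Φ : ρ → ℝ → Em 4}

/-- The coordinate law of a DSS wave: `(Φ_r)_j' = −(Φ_r)_j + (Q + Λ A + Λ⁻¹ B)_j`.
[cite: Tao2016AveragedNS, §4 Lemma 4.1 (iii) (4.8); cell theorem] -/
theorem dss_hasDerivAt_coord (hW : IsDSSWave ε₀ α π T Φ) (r : ρ) (j : Fin 4) (x : ℝ) :
    HasDerivAt (fun y => Φ r y j) (-(Φ r x j) + (tableQ α (Φ r x)
      + bigLam ε₀ • tableA α (Φ (π.symm r) (x + T))
      + (bigLam ε₀)⁻¹ • tableB α (Φ (π r) (x - T)) (Φ r x)) j) x := by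
  have hw := hW.wave r x
  have hc := ((EuclideanSpace.proj j : Em 4 →L[ℝ] ℝ).hasFDerivAt).comp_hasDerivAt x hw
  have heq : ((EuclideanSpace.proj j : Em 4 →L[ℝ] ℝ) : Em 4 → ℝ) ∘ Φ r = fun y => Φ r y j := by
    funext y
    simp [EuclideanSpace.coe_proj]
  rw [heq] at hc
  have hv : -((1 : ℝ) • Φ r x) + tableQ α (Φ r x) + bigLam ε₀ • tableA α (Φ (π.symm r) (x + T))
        + (bigLam ε₀)⁻¹ • tableB α (Φ (π r) (x - T)) (Φ r x)
      = -((1 : ℝ) • Φ r x) + (tableQ α (Φ r x) + bigLam ε₀ • tableA α (Φ (π.symm r) (x + T))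
        + (bigLam ε₀)⁻¹ • tableB α (Φ (π r) (x - T)) (Φ r x)) := by abel
  rw [hv] at hc
  refine hc.congr_deriv ?_
  rw [EuclideanSpace.coe_proj]
  beta_reduce
  rw [PiLp.add_apply, PiLp.neg_apply, PiLp.smul_apply, smul_eq_mul, one_mul]

/-- Coordinates of DSS profiles are continuous. [cite: Tao2016AveragedNS, §4 Lemma 4.1 (4.8); cell theorem] -/
theorem dss_continuous_coord (hW : IsDSSWave ε₀ α π T Φ) (r : ρ) (j : Fin 4) :
    Continuous (fun y => Φ r y j) :=
  (EuclideanSpace.proj j : Em 4 →L[ℝ] ℝ).continuous.comp (hW.wave.continuous r)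

/-- Coordinates of DSS profiles are bounded. [cite: Tao2016AveragedNS, §4 Lemma 4.1 (4.8); cell theorem] -/
theorem dss_bounded_coord (hW : IsDSSWave ε₀ α π T Φ) (r : ρ) (j : Fin 4) :
    ∃ B : ℝ, ∀ y, |Φ r y j| ≤ B := by
  obtain ⟨C, hC⟩ := hW.uniformBound
  refine ⟨C, fun y => ?_⟩
  have h1 : ‖(Φ r y) j‖ ≤ ‖Φ r y‖ := PiLp.norm_apply_le (Φ r y) j
  rw [Real.norm_eq_abs] at h1
  exact h1.trans (hC r y)

/-- Coordinates of DSS profiles are integrable (admissibility clause `mass`).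
[cite: Tao2016AveragedNS, §4 Lemma 4.1 (4.8); cell theorem] -/
theorem dss_integrable_coord (hW : IsDSSWave ε₀ α π T Φ) (r : ρ) (j : Fin 4) :
    Integrable (fun y => Φ r y j) := by
  refine hW.mass.mono' (dss_continuous_coord hW r j).aestronglyMeasurable
    (Eventually.of_forall fun y => ?_)
  have h1 : ‖(Φ r y) j‖ ≤ ‖Φ r y‖ := PiLp.norm_apply_le (Φ r y) j
  exact h1.trans (norm_le_sMass Φ y r)

end DSS

/-! ## The unseeded Toda member carries no admissible DSS wave -/

/-- **No non-trivial admissible DSS wave lives on the UNSEEDED graded Toda member `T_0 ∈ E₂(2)`**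
(any scale ratio, any period, any delay).  Bond coordinates obey `v' = −v + (a − Λ⁻¹a₊(·−T)) v` with
an integrable multiplier, hence vanish (`eq_zero_of_hasDerivAt_damped_mul_integrable`); then every
carrier and every inert coordinate decays freely, `φ' = −φ`, hence vanishes.  So on `T_0` every
«no DSS wave» predicate holds vacuously, `T_0` can never witness `¬ TailRatchet` through waves, and the
seed `ε a²` of `CircuitPump` is exactly what makes its pump possible.
[cite: Tao2016AveragedNS, §4 Lemma 4.1 (4.8); cell theorem] -/
theorem unseededToda_dssWave_trivial {ρ : Type*} [Fintype ρ] {ε₀ ε : ℝ} (hε : ε = 0)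
    {α : Fin 4 → Fin 4 → Fin 4 → ℤ × ℤ × ℤ → ℝ} (hα : α = (fun (i₁ i₂ i₃ : Fin 4) (μ : ℤ × ℤ × ℤ) =>
      if μ = ((0 : ℤ), (0 : ℤ), (0 : ℤ)) then
        (if i₁ = 1 ∧ i₂ = 1 ∧ i₃ = 0 then (-1 : ℝ) else if i₁ = 1 ∧ i₂ = 0 ∧ i₃ = 1 then 1 / 2
         else if i₁ = 0 ∧ i₂ = 1 ∧ i₃ = 1 then 1 / 2 else if i₁ = 0 ∧ i₂ = 0 ∧ i₃ = 1 then ε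
         else if i₁ = 0 ∧ i₂ = 1 ∧ i₃ = 0 then -ε / 2 else if i₁ = 1 ∧ i₂ = 0 ∧ i₃ = 0 then -ε / 2 else 0)
      else if μ = ((0 : ℤ), (0 : ℤ), (1 : ℤ)) then (if i₁ = 1 ∧ i₂ = 1 ∧ i₃ = 0 then 1 else 0)
      else if μ = ((0 : ℤ), (1 : ℤ), (0 : ℤ)) then (if i₁ = 1 ∧ i₂ = 0 ∧ i₃ = 1 then -1 / 2 else 0)
      else if μ = ((1 : ℤ), (0 : ℤ), (0 : ℤ)) then (if i₁ = 0 ∧ i₂ = 1 ∧ i₃ = 1 then -1 / 2 else 0)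
      else 0))
    {π : Equiv.Perm ρ} {T : ℝ} {Φ : ρ → ℝ → Em 4} (hW : IsDSSWave ε₀ α π T Φ) :
    ∀ (r : ρ) (x : ℝ), Φ r x = 0 := by
  -- bonds
  have h1 : ∀ (r : ρ) (x : ℝ), Φ r x 1 = 0 := by
    intro r
    have hh : Continuous (fun x => Φ r x 0 - (bigLam ε₀)⁻¹ * Φ (π r) (x - T) 0) :=
      (dss_continuous_coord hW r 0).sub
        (((dss_continuous_coord hW (π r) 0).comp (continuous_id.sub continuous_const)).const_mul _)
    have hint : Integrable (fun x => Φ r x 0 - (bigLam ε₀)⁻¹ * Φ (π r) (x - T) 0) :=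
      (dss_integrable_coord hW r 0).sub
        (((dss_integrable_coord hW (π r) 0).comp_sub_right T).const_mul _)
    refine eq_zero_of_hasDerivAt_damped_mul_integrable hh hint (fun x => ?_) (dss_bounded_coord hW r 1)
    refine (dss_hasDerivAt_coord hW r 1 x).congr_deriv ?_
    rw [(seededToda_drive hα _ _ _ _).2.1, hε]
    ring
  -- carriers
  have h0 : ∀ (r : ρ) (x : ℝ), Φ r x 0 = 0 := by
    intro r
    refine eq_zero_of_hasDerivAt_free (fun x => ?_) (dss_bounded_coord hW r 0)
    refine (dss_hasDerivAt_coord hW r 0 x).congr_deriv ?_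
    rw [(seededToda_drive hα _ _ _ _).1, h1 r x, h1 (π.symm r) (x + T)]
    ring
  -- inert coordinates
  have h2 : ∀ (r : ρ) (x : ℝ), Φ r x 2 = 0 := by
    intro r
    refine eq_zero_of_hasDerivAt_free (fun x => ?_) (dss_bounded_coord hW r 2)
    refine (dss_hasDerivAt_coord hW r 2 x).congr_deriv ?_
    rw [(seededToda_drive hα _ _ _ _).2.2.1, add_zero]
  have h3 : ∀ (r : ρ) (x : ℝ), Φ r x 3 = 0 := by
    intro r
    refine eq_zero_of_hasDerivAt_free (fun x => ?_) (dss_bounded_coord hW r 3)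
    refine (dss_hasDerivAt_coord hW r 3 x).congr_deriv ?_
    rw [(seededToda_drive hα _ _ _ _).2.2.2, add_zero]
  intro r x
  ext j
  fin_cases j
  · simpa using h0 r x
  · simpa using h1 r x
  · simpa using h2 r x
  · simpa using h3 r x

/-! ## Kill criteria at FIXED seed -/

/-- **Admissible DSS waves of the seeded Toda member at FIXED seed refute `TailRatchet`.**  If for some
`ε ∈ (0,1]` the table `T_ε` carries non-trivial admissible DSS waves (any period, any delay) at
arbitrarily small scale ratios, `TailRatchet` is false (`tailRatchet_false_of_persistentDSSWaves` at
`R = 2/ε`).  Negative lemma modulo that construction — the inviscid shadow of `CircuitPump` made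
uniform in `λ ↓ 1` at fixed seed.
[cite: Tao2016AveragedNS, §4; cell theorem] -/
theorem TailRatchet_false_of_seededTodaDSSWaves {ε : ℝ} (hε : 0 < ε) (hε1 : ε ≤ 1)
    {α : Fin 4 → Fin 4 → Fin 4 → ℤ × ℤ × ℤ → ℝ} (hα : α = (fun (i₁ i₂ i₃ : Fin 4) (μ : ℤ × ℤ × ℤ) =>
      if μ = ((0 : ℤ), (0 : ℤ), (0 : ℤ)) then
        (if i₁ = 1 ∧ i₂ = 1 ∧ i₃ = 0 then (-1 : ℝ) else if i₁ = 1 ∧ i₂ = 0 ∧ i₃ = 1 then 1 / 2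
         else if i₁ = 0 ∧ i₂ = 1 ∧ i₃ = 1 then 1 / 2 else if i₁ = 0 ∧ i₂ = 0 ∧ i₃ = 1 then ε
         else if i₁ = 0 ∧ i₂ = 1 ∧ i₃ = 0 then -ε / 2 else if i₁ = 1 ∧ i₂ = 0 ∧ i₃ = 0 then -ε / 2 else 0)
      else if μ = ((0 : ℤ), (0 : ℤ), (1 : ℤ)) then (if i₁ = 1 ∧ i₂ = 1 ∧ i₃ = 0 then 1 else 0)
      else if μ = ((0 : ℤ), (1 : ℤ), (0 : ℤ)) then (if i₁ = 1 ∧ i₂ = 0 ∧ i₃ = 1 then -1 / 2 else 0)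
      else if μ = ((1 : ℤ), (0 : ℤ), (0 : ℤ)) then (if i₁ = 0 ∧ i₂ = 1 ∧ i₃ = 1 then -1 / 2 else 0)
      else 0))
    (hF : ∀ δ : ℝ, 0 < δ → ∃ ε₀ : ℝ, 0 < ε₀ ∧ ε₀ ≤ δ ∧
      ∃ (q : ℕ) (π : Equiv.Perm (Fin q)) (T : ℝ) (Φ : Fin q → ℝ → Em 4),
        IsDSSWave ε₀ α π T Φ ∧ ∃ r x, Φ r x ≠ 0) :
    ¬ Summit.NavierStokesRegularity.NavierStokesRegularity.Theses.WakeRatchet.TailRatchet := by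
  have hR : (1 : ℝ) ≤ 2 / ε := by
    rw [le_div_iff₀ hε]; linarith
  refine WakeRatchetTailRatchetNegative.tailRatchet_false_of_persistentDSSWaves hR fun δ hδ => ?_
  obtain ⟨ε₀, hε₀, hle, q, π, T, Φ, hW, hne⟩ := hF δ hδ
  exact ⟨ε₀, hε₀, hle, α, inTableClass_seededToda hε hε1 hα, q, π, T, Φ, hW, hne⟩

/-- **Uniformly bounded admissible viscous block-DSS eternal solutions of the seeded Toda member at
FIXED seed refute `TailRatchet`** — the exact shape of `PerpetualPump.CircuitPump`'s output (period
`p = 1`, delay `T = 2 log(1+ε₀)`, `ν̂ = 1`), read in renormalised variables with the admissibility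
clauses of `IsEternalVisc` and `UniformBound`, but demanded at ONE seed `ε ∈ (0,1]` for arbitrarily
small `ε₀` (`tailRatchet_false_of_persistent_blockDSS_visc` at `R = 2/ε`).  `CircuitPump` itself
supplies such solutions only with `ε = ε(λ) → 0`, i.e. at unbounded spread.
[cite: Tao2016AveragedNS, §4, the viscous equation before Thm. 4.2; cell theorem] -/
theorem TailRatchet_false_of_seededTodaViscousPumps {ε : ℝ} (hε : 0 < ε) (hε1 : ε ≤ 1)
    {α : Fin 4 → Fin 4 → Fin 4 → ℤ × ℤ × ℤ → ℝ} (hα : α = (fun (i₁ i₂ i₃ : Fin 4) (μ : ℤ × ℤ × ℤ) =>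
      if μ = ((0 : ℤ), (0 : ℤ), (0 : ℤ)) then
        (if i₁ = 1 ∧ i₂ = 1 ∧ i₃ = 0 then (-1 : ℝ) else if i₁ = 1 ∧ i₂ = 0 ∧ i₃ = 1 then 1 / 2
         else if i₁ = 0 ∧ i₂ = 1 ∧ i₃ = 1 then 1 / 2 else if i₁ = 0 ∧ i₂ = 0 ∧ i₃ = 1 then ε
         else if i₁ = 0 ∧ i₂ = 1 ∧ i₃ = 0 then -ε / 2 else if i₁ = 1 ∧ i₂ = 0 ∧ i₃ = 0 then -ε / 2 else 0)
      else if μ = ((0 : ℤ), (0 : ℤ), (1 : ℤ)) then (if i₁ = 1 ∧ i₂ = 1 ∧ i₃ = 0 then 1 else 0)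
      else if μ = ((0 : ℤ), (1 : ℤ), (0 : ℤ)) then (if i₁ = 1 ∧ i₂ = 0 ∧ i₃ = 1 then -1 / 2 else 0)
      else if μ = ((1 : ℤ), (0 : ℤ), (0 : ℤ)) then (if i₁ = 0 ∧ i₂ = 1 ∧ i₃ = 1 then -1 / 2 else 0)
      else 0))
    (hF : ∀ δ : ℝ, 0 < δ → ∃ ε₀ : ℝ, 0 < ε₀ ∧ ε₀ ≤ δ ∧
      ∃ (νh : ℝ) (W : ℤ → ℝ → Em 4) (p : ℕ) (T : ℝ), 0 < T ∧ IsEternalVisc ε₀ νh α W ∧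
        UniformBound W ∧ (∀ (n : ℤ) (σ : ℝ), W (n + p) σ = W n (σ - T)) ∧ ∃ n σ, W n σ ≠ 0) :
    ¬ Summit.NavierStokesRegularity.NavierStokesRegularity.Theses.WakeRatchet.TailRatchet := by
  have hR : (1 : ℝ) ≤ 2 / ε := by
    rw [le_div_iff₀ hε]; linarith
  refine WakeRatchetDSS.tailRatchet_false_of_persistent_blockDSS_visc hR fun δ hδ => ?_
  obtain ⟨ε₀, hε₀, hle, νh, W, p, T, hT, hW, hU, hD, hne⟩ := hF δ hδ
  exact ⟨ε₀, hε₀, hle, α, inTableClass_seededToda hε hε1 hα, νh, W, p, T, hT, hW, hU, hD, hne⟩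

end WakeRatchetSeededToda

end Summit.NavierStokesRegularity.NavierStokesRegularity.Theorems

end
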